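import Summits.QuantumFields.BalabanUV.T4Continuum.Support.ShellMeasurePropagatorCombesThomas

/-!
# `T4Continuum.ShellMeasurePropagatorCombesThomasScaled` — corollaries of the second-order Combes–Thomas bound: the HERMITIAN
# form (`h(cosh θ − 1) ≤ m∕2`), the η-UNIFORM form for fine-lattice operators, the first-order form as a special case, and a
# decided numeric instance of the gain
(cell `pub-balaban`, sub-cell `t4`, spine estimate NE7c (node U5b); NE7c ROUND-2 crew `t4-ne7c-formalise-*`, unit
`b2b-balaban-t4-ne7c-formalise-leaf-02` gen 13; journal NOTE N-ne7cleaf02g13-1 (2026-08-20, l.22964 ∕ STAGED l.23176) for the owner's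
γ18 «THE FLOOR» memo, species (α); file 3∕3 — imports file 2 `ShellMeasurePropagatorCombesThomas` ONLY and touches NO host;
[folklore]; 0 `def`, 0 `def … : Prop`, 0 sorry, 0 citation tags of Bałaban's.)

HONEST FRAMING.  Finite four-torus programme, rung (B)+1 only — NOT infinite volume, NOT a mass gap, NOT the Clay problem, NOT
summit progress.  NE7c (`T4IndicatorShell.ShellWeightBound`) is NOT PRINTED in [Balaban 1983–89] and NOT PROVED; «NE7c ⇐ the named
binders» (trigger c3).  Generic matrix corollaries; the gap (`hacc`) is a HYPOTHESIS ([Balaban1985Variational] (29)–(31)∕Prop. 3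
TYPE); ℓ²-matrix-entry ∕ ℓ²-block statements only — no sup-∕Hölder-∕∇-norm statement of [Balaban1985BackgroundPropagators]
(3.133)'s currency; nothing of Bałaban's asserted, cited or discharged; no census row moves.  HONEST DEPENDENCY (cell): continuum
YM on T⁴ ⇐ BetaPertH ∧ nine spine estimates (0/9 proved); BetaPertH ⇐ (D1) ∧ (D4) ∧ CAP+tail; G-an2-4 gates asym, D1 and NE2/3/4.

CONTENT.  `hermitian_combes_thomas` — `A` Hermitian: column sums follow from row sums, skew part `0`, condition
`h(cosh θ − 1) ≤ m∕2` (rate `θ ≍ √(m∕h)`; the «η ↦ Cη^{1∕2}» phenomenon of Barbaroux–Combes–Hislop, Helv. Phys. Acta 70 (1997),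
below the spectrum, for finite matrices).  `secondOrder_combes_thomas_scaled` — the η-UNIFORM form: gap `η²m`, Hermitian-part
sums `≤ h`, skew-part sums `≤ 2ηh_K` (a complexified unitary background `e^{iη𝐀}`, `|Im 𝐀| ≤ ε`, has skew part `O(ηε)` in fine
units), `0 < η ≤ 1`, and the η-FREE condition `h(cosh θ − 1) + h_K sinh θ ≤ m∕2` give `|A⁻¹ᵢⱼ| ≤ (2∕(η²m))·e^{−(ηθ)·dist(i,j)}`,
i.e. for `H = η^{−2}A`: `|H⁻¹(x,y)| ≤ (2∕m)·e^{−θ·(η·dist(x,y))}` — rate `θ` per unit COARSE length for EVERY `η`; under the tree's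
first-order condition the fine rate would be `O(η²)`.  `example`s: the first-order condition `h(e^θ − 1) ≤ m∕2` is the case
`h_K := h` of the second-order theorem; for `h = 8`, `m = 1∕2` the rate `θ = 1∕5` passes the Hermitian condition and fails
the first-order one.

PRIOR DEVICES IN THE TREE (honest; leaf-05-g12's MAP N-ne7cL05g12-1, adopted R-ne7cp1-g37-7).  The second-order (cosh) budget,
the first-order remainder for the anti-Hermitian part of a complexified background, the pairing∕block form without volume
factor and the η-uniformity device `n²(cosh(κ∕n) − 1) ≤ (κ²∕2)e^{κ²∕2}` ALREADY exist in the tree, in richer currencies: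
`Summits/…/BalabanUV/Beta/AccretiveCombesThomas` (`conjForm`, `combesThomas_of_conjCoercive`, `norm_inv_apply_le`) and
`…/AccretiveCombesThomasBudget` (`conjLower_of_isHermitian` — second order; `conjLower_of_expDefect` — first order;
`ctRowDefect_le_of_range` — kernels of block RANGE), `Literature/…/Balaban1983to89/Beta/DeltaACombesThomas` (`combesThomas_pairwise`,
`ctRowDefect_Lap_le_uniform`), `…/Beta/TorusG0Decay.setDecay_torus`, and the multiscale ENDs `Beta/MultiscaleDecay(.Dirichlet)`,
`Beta/MultiscaleCombesThomasL2Cells` (cell-to-cell ℓ², local prefactors).  Files 1–3 of this set are a COMPACT GENERIC TWIN in the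
`Literature/Analysis/Matrix` currency (ℕ pseudo-metric, `Matrix ι ι ℂ`, the tree's `accretive_combes_thomas` binders verbatim + one
skew row) — NO new mechanism.  LIMITATION of the range-one form: a term of BLOCK range in the fine metric (the averaging
`a·Q*Q` of [Balaban1985BackgroundPropagators] (3.24)) is NOT range one; measured in a block pseudo-metric it is, but then the
Laplacian's weight jump concentrates on block boundaries and the η-uniformity is lost — for such operators use the `Beta/`
defect-budget theorems above (scale-adapted distance), not this file.
-/

noncomputable section

open Finset
open scoped Matrix ComplexConjugate

namespace Summit.QuantumFields.BalabanUV.T4Continuum.ShellMeasurePropagatorCombesThomasScaled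

open Literature.Analysis.Matrix (accretive_combes_thomas)
open ShellMeasurePropagatorCombesThomasPrelims ShellMeasurePropagatorCombesThomas

section Corollaries

variable {ι : Type*} [Fintype ι] [DecidableEq ι]

/-- **The Hermitian Combes–Thomas bound** (second order): for a HERMITIAN range-one `A` with off-site absolute row sums `≤ h`
(column sums follow), `m`-accretive (`= A ≥ m`), and `θ ≥ 0` with **`h(cosh θ − 1) ≤ m∕2`**: `|A⁻¹ᵢⱼ| ≤ (2∕m)e^{−θ·dist(i,j)}`.
For small `m∕h` the admissible rate is `θ ≍ √(m∕h)` against the first-order `θ ≍ m∕(2h)`. [folklore] -/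
theorem hermitian_combes_thomas (dist : ι → ι → ℕ) (hd0 : ∀ i, dist i i = 0)
    (hds : ∀ i j, dist i j = dist j i) (hdt : ∀ i j k, dist i k ≤ dist i j + dist j k)
    (A : Matrix ι ι ℂ) (hA : A.IsHermitian) (hrange : ∀ i j, A i j ≠ 0 → dist i j ≤ 1) (h : ℝ)
    (hrow : ∀ i, ∑ j ∈ univ.filter (fun j => dist i j ≠ 0), ‖A i j‖ ≤ h)
    (m θ : ℝ) (hm : 0 < m) (hθ : 0 ≤ θ)
    (hacc : ∀ v : ι → ℂ, m * ∑ i, ‖v i‖ ^ 2 ≤ (∑ i, star (v i) * (A *ᵥ v) i).re)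
    (hsm : h * (Real.cosh θ - 1) ≤ m / 2) :
    IsUnit A.det ∧ ∀ i j, ‖A⁻¹ i j‖ ≤ 2 / m * Real.exp (-(θ * dist i j)) := by
  have hcol : ∀ j, ∑ i ∈ univ.filter (fun i => dist i j ≠ 0), ‖A i j‖ ≤ h := by
    intro j
    have e : ∀ i, ‖A i j‖ = ‖A j i‖ := fun i => by rw [← hA.apply i j, norm_star]
    simp_rw [e, hds _ j]
    exact hrow j
  refine secondOrder_combes_thomas dist hd0 hds hdt A hrange h hrow hcol 0 (fun i => ?_) m θ hm hθ hacc
    (by simpa using hsm)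
  have e : ∀ j, ‖A i j - star (A j i)‖ = 0 := fun j => by rw [hA.apply i j, sub_self, norm_zero]
  rw [sum_congr rfl fun j _ => e j, sum_const_zero, mul_zero]

/-- **The η-UNIFORM form.**  Let `A` be range-one with off-site absolute row∕column sums `≤ h`, skew-part row sums `≤ 2·(η·h_K)`,
and `(η²·m)`-accretive, `0 < η ≤ 1` — the shape of a nearest-neighbour lattice operator `H` with entries `O(η^{−2})` and gap
`m` per unit COARSE length, written as `A = η²H`, whose skew (non-Hermitian) part is `O(η)` in these units (a complexified
unitary background `e^{iη𝐀}`, `|Im 𝐀| ≤ ε`).  If `θ ≥ 0` satisfies the η-FREE condition `h(cosh θ − 1) + h_K sinh θ ≤ m∕2`, then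
`|A⁻¹ᵢⱼ| ≤ (2∕(η²m))·e^{−(ηθ)·dist(i,j)}`, i.e. `|H⁻¹(x,y)| = η²|A⁻¹| ≤ (2∕m)·e^{−θ·(η·dist(x,y))}`: exponential decay at rate `θ`
per unit coarse length (`η·dist` = coarse distance), the SAME `θ` for every lattice spacing.  Under the first-order condition of
the tree's `accretive_combes_thomas` the admissible fine rate would be `O(η²)` instead of `ηθ`.  HONEST: ℓ²-matrix entries only;
the gap is a hypothesis; no sup-∕Hölder-norm or ∇ statement ([B9] (3.133)'s currency) is made. [folklore] -/
theorem secondOrder_combes_thomas_scaled (dist : ι → ι → ℕ) (hd0 : ∀ i, dist i i = 0)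
    (hds : ∀ i j, dist i j = dist j i) (hdt : ∀ i j k, dist i k ≤ dist i j + dist j k)
    (A : Matrix ι ι ℂ) (hrange : ∀ i j, A i j ≠ 0 → dist i j ≤ 1) (h hK m θ η : ℝ)
    (hrow : ∀ i, ∑ j ∈ univ.filter (fun j => dist i j ≠ 0), ‖A i j‖ ≤ h)
    (hcol : ∀ j, ∑ i ∈ univ.filter (fun i => dist i j ≠ 0), ‖A i j‖ ≤ h)
    (hskew : ∀ i, ∑ j ∈ univ.filter (fun j => dist i j ≠ 0), ‖A i j - star (A j i)‖ ≤ 2 * (η * hK))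
    (hm : 0 < m) (hθ : 0 ≤ θ) (hη0 : 0 < η) (hη1 : η ≤ 1) (hK0 : 0 ≤ hK)
    (hacc : ∀ v : ι → ℂ, η ^ 2 * m * ∑ i, ‖v i‖ ^ 2 ≤ (∑ i, star (v i) * (A *ᵥ v) i).re)
    (hsm : h * (Real.cosh θ - 1) + hK * Real.sinh θ ≤ m / 2) :
    IsUnit A.det ∧ ∀ i j, ‖A⁻¹ i j‖ ≤ 2 / (η ^ 2 * m) * Real.exp (-(η * θ * dist i j)) := by
  have hm' : 0 < η ^ 2 * m := by positivity
  -- invertibility does not need `h ≥ 0`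
  have hdet : IsUnit A.det :=
    (accretive_combes_thomas dist hd0 hds hdt A hrange h hrow hcol (η ^ 2 * m) 0 hm' le_rfl hacc
      (by rw [Real.exp_zero, sub_self, mul_zero]; positivity)).1
  refine ⟨hdet, fun i j => ?_⟩
  have hh0 : 0 ≤ h := (sum_nonneg fun _ _ => norm_nonneg _).trans (hrow j)
  have hsm' : h * (Real.cosh (η * θ) - 1) + η * hK * Real.sinh (η * θ) ≤ η ^ 2 * m / 2 := by
    have h1 : h * (Real.cosh (η * θ) - 1) ≤ h * (η ^ 2 * (Real.cosh θ - 1)) :=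
      mul_le_mul_of_nonneg_left (cosh_mul_sub_one_le_sq_mul hη0.le hη1 hθ) hh0
    have h2 : η * hK * Real.sinh (η * θ) ≤ η * hK * (η * Real.sinh θ) :=
      mul_le_mul_of_nonneg_left (sinh_mul_le_mul_sinh hη0.le hη1 hθ) (by positivity)
    have h3 : η ^ 2 * (h * (Real.cosh θ - 1) + hK * Real.sinh θ) ≤ η ^ 2 * (m / 2) :=
      mul_le_mul_of_nonneg_left hsm (by positivity)
    nlinarith
  have hmain := (secondOrder_combes_thomas dist hd0 hds hdt A hrange h hrow hcol (η * hK) hskew (η ^ 2 * m)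
    (η * θ) hm' (by positivity) hacc hsm').2 i j
  simpa only [mul_assoc] using hmain

/-- Consistency: the tree's FIRST-ORDER condition `h(e^θ − 1) ≤ m∕2` is the special case `h_K = h` — the skew-part row sum is
at most the row sum plus the column sum, and `(cosh θ − 1) + sinh θ = e^θ − 1`. [folklore] -/
example (dist : ι → ι → ℕ) (hd0 : ∀ i, dist i i = 0)
    (hds : ∀ i j, dist i j = dist j i) (hdt : ∀ i j k, dist i k ≤ dist i j + dist j k)
    (A : Matrix ι ι ℂ) (hrange : ∀ i j, A i j ≠ 0 → dist i j ≤ 1) (h : ℝ)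
    (hrow : ∀ i, ∑ j ∈ univ.filter (fun j => dist i j ≠ 0), ‖A i j‖ ≤ h)
    (hcol : ∀ j, ∑ i ∈ univ.filter (fun i => dist i j ≠ 0), ‖A i j‖ ≤ h)
    (m θ : ℝ) (hm : 0 < m) (hθ : 0 ≤ θ)
    (hacc : ∀ v : ι → ℂ, m * ∑ i, ‖v i‖ ^ 2 ≤ (∑ i, star (v i) * (A *ᵥ v) i).re)
    (hη : h * (Real.exp θ - 1) ≤ m / 2) :
    IsUnit A.det ∧ ∀ i j, ‖A⁻¹ i j‖ ≤ 2 / m * Real.exp (-(θ * dist i j)) := by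
  refine secondOrder_combes_thomas dist hd0 hds hdt A hrange h hrow hcol h (fun i => ?_) m θ hm hθ hacc ?_
  · have hc : ∑ j ∈ univ.filter (fun j => dist i j ≠ 0), ‖A j i‖ ≤ h := by
      have := hcol i; simp_rw [hds _ i] at this; exact this
    calc ∑ j ∈ univ.filter (fun j => dist i j ≠ 0), ‖A i j - star (A j i)‖
        ≤ ∑ j ∈ univ.filter (fun j => dist i j ≠ 0), (‖A i j‖ + ‖A j i‖) :=
          sum_le_sum fun j _ => (norm_sub_le _ _).trans (by rw [norm_star])
      _ = _ := sum_add_distrib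
      _ ≤ 2 * h := by linarith [hrow i]
  · rw [exp_eq_one_add_cosh_sub_one_add_sinh] at hη; linarith

end Corollaries

/-! ## §3 A numeric instance of the gain (crew rule G-1 style, decided arithmetic)

For the nearest-neighbour stencil of `ℤ⁴` with unit entries (`h = 8`) and gap `m = 1∕2` in fine units the first-order condition
`8(e^θ − 1) ≤ 1∕4` needs `θ ≤ log(33∕32) < 0.031`, while the Hermitian condition `8(cosh θ − 1) ≤ 1∕4` admits `θ = 1∕5`
(`cosh(1∕5) ≤ e^{1∕50} ≤ 1.0203`, so `8·0.0203 ≤ 0.25`). -/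

/-- `θ = 1∕5` is admissible for `h = 8`, `m = 1∕2` in the Hermitian condition. [folklore] -/
example : (8 : ℝ) * (Real.cosh (1 / 5) - 1) ≤ (1 / 2) / 2 := by
  have h1 : Real.cosh (1 / 5) ≤ Real.exp ((1 / 5) ^ 2 / 2) := Real.cosh_le_exp_half_sq _
  have h2 : Real.exp ((1 / 5 : ℝ) ^ 2 / 2) ≤ 1 + (1 / 5 : ℝ) ^ 2 / 2 + ((1 / 5 : ℝ) ^ 2 / 2) ^ 2 := by
    have hx : |((1 / 5 : ℝ) ^ 2 / 2)| ≤ 1 := by norm_num [abs_of_nonneg]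
    have := Real.abs_exp_sub_one_sub_id_le hx
    have h3 := abs_le.mp this
    nlinarith [h3.2]
  nlinarith

/-- … while the first-order condition FAILS at `θ = 1∕5` (indeed at any `θ ≥ 1∕25`): `8(e^{1∕5} − 1) > 1∕4`. [folklore] -/
example : ¬ ((8 : ℝ) * (Real.exp (1 / 5) - 1) ≤ (1 / 2) / 2) := by
  have h1 : (1 : ℝ) / 5 + 1 ≤ Real.exp (1 / 5) := Real.add_one_le_exp _
  intro h; nlinarith

end Summit.QuantumFields.BalabanUV.T4Continuum.ShellMeasurePropagatorCombesThomasScaled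

end
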